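/-
Width seat `ym-line-cbag-p1-w3` (prover-ym-line-cbag-p1-w3-g8-0; own items stmt-QuantumFields-22254 / 22893 CLOSED proved), helping LINE 3
`route-QuantumFields-SixPlaneColdBox` (crux stmt-QuantumFields-25709 `DensityTransferG`): the torus side of the six-plane DLR transfer —
the six-plane torus correlator and the six-plane torus means read through the box kernels.
-/
import Summits.QuantumFields.YangMills.Theorems.SixPlaneColdBoxTorusMeanKernel
import Summits.QuantumFields.YangMills.Theorems.SixPlaneColdBoxTorusDensityPairs
import Summits.QuantumFields.YangMills.Theorems.ColdBoxAllGroupsBoxAllPairsCoreG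
import Summits.QuantumFields.YangMills.Theorems.ColdBoxAllGroupsBoxFloorAllGroupsGoodReductionG
import Summits.QuantumFields.YangMills.Theorems.ColdBoxAllGroupsBulkAllGroupsDlrPlumbingG
import Summits.QuantumFields.YangMills.Theorems.ColdBoxAllGroupsBulkAllGroupsKernelGoodEventG

/-!
# Route `SixPlaneColdBox`, crux `DensityTransferG`: the torus side of the transfer through the box kernels

For the torus of side `2S+1 > 2(2H+T+2)`, a continuous unitary `ρ` and the six-plane cost sums `F = Σ_q c_{(c_H;q)}`, `F' = Σ_q c_{(c_H+Te₀;q)}`: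

* `sixPlane_torusCorr_eq_kernel` — `⟨actionDensity ; actionDensity⟩_{torus,T} = ∫ K_U[F F'] dμ − (∫ K_U[F] dμ)(∫ K_U[F'] dμ)`, `K_U` the box kernel
  `boxKernelG ρ β H (torusLift (2S+1) U)`, `μ` the torus Wilson state (sum over the 36 plane pairs of p1's pair identity
  `latticeConnectedCorr_pair_eq_boxKernelG`, `latticeConnectedCorr_actionDensity_eq_sum_pairs`);
* `sixPlane_torusMean_eq` — `∫ K_U[F] dμ = Σ_q ∫ plaqCost0 ρ q ∘ torusLift dμ` and the same for `F'` (`torusMean_eq_kernelMean_pairG`);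
* `abs_sixPlaneSum_le` — `|Σ_q c_{(x;q)}| ≤ card·2N`; `integrable_kernelMean_of_bound` — bounded continuous box-kernel means are integrable.

Plumbing only (DLR + translation invariance).  No sorry; standard axioms.  NOT the Yang–Mills mass gap; no item is proved here.
-/

set_option autoImplicit false

noncomputable section

open MeasureTheory ProbabilityTheory Finset Real Filter Topology Metric
open scoped ENNReal
open Literature.Probability.LatticeModels (Site glueWith)
open Literature.MathematicalPhysics.QuantumLattice
open Literature.MathematicalPhysics.QuantumFieldTheory
open Literature.MathematicalPhysics.QuantumFieldTheory.LatticeMaxwell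
open Literature.MathematicalPhysics.QuantumFieldTheory.AxialGauge
open Summit.QuantumFields.YangMills.Theorems.WeakCouplingRates
open Summit.QuantumFields.YangMills.Theorems.FreeEnergyLogCoefficient
open Summit.QuantumFields.YangMills.Theorems.ColdBoxAllGroups

namespace Summit.QuantumFields.YangMills.Theorems.SixPlaneColdBox

variable {N : ℕ} {G : Type} [Group G] [TopologicalSpace G] [IsTopologicalGroup G] [CompactSpace G]
  [MeasurableSpace G] [BorelSpace G] [SecondCountableTopology G]
variable (ρ : G →* Matrix (Fin N) (Fin N) ℂ)

omit [TopologicalSpace G] [IsTopologicalGroup G] [CompactSpace G] [MeasurableSpace G] [BorelSpace G]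
  [SecondCountableTopology G] in
/-- The six-plane cost sum at any site is bounded by `card·2N`. -/
theorem abs_sixPlaneSum_le (hρu : ∀ g, ρ g ∈ Matrix.unitaryGroup (Fin N) ℂ) (x : Site 4) (W : LGConfig 4 G) :
    |∑ q : {q : Fin 4 × Fin 4 // q.1 < q.2}, plaqCostAt ρ x q.1.1 q.1.2 W| ≤
      (Fintype.card {q : Fin 4 × Fin 4 // q.1 < q.2} : ℝ) * (2 * (N : ℝ)) := by
  refine (Finset.abs_sum_le_sum_abs _ _).trans ?_
  calc ∑ q : {q : Fin 4 × Fin 4 // q.1 < q.2}, |plaqCostAt ρ x q.1.1 q.1.2 W|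
      ≤ ∑ _q : {q : Fin 4 × Fin 4 // q.1 < q.2}, 2 * (N : ℝ) := Finset.sum_le_sum fun q _ => abs_plaqCostAt_leG ρ hρu _ q.1.1 q.1.2 W
    _ = _ := by rw [Finset.sum_const, Finset.card_univ, nsmul_eq_mul]

/-- A bounded continuous observable read through the box kernel at the periodic lift is integrable over the torus Wilson state. -/
theorem integrable_kernelMean_of_bound (hρc : Continuous ρ) (β : ℝ) (H S : ℕ) {f : LGConfig 4 G → ℝ} {C : ℝ} (hf : Continuous f)
    (hC : ∀ W, |f W| ≤ C) :
    Integrable (fun U : GaugeConfig 4 (2 * S + 1) G => ∫ W, f W ∂(boxKernelG ρ β H (torusLift (2 * S + 1) U)))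
      (wilsonMeasure (d := 4) (L := 2 * S + 1) ρ β) := by
  haveI := isProbabilityMeasure_wilsonMeasure (d := 4) (L := 2 * S + 1) (G := G) ρ hρc β
  refine Integrable.of_bound
    ((continuous_integral_ymSpecification ρ hρc β (AxialGauge.boxEdges 4 (2 * H + 1)) hf hC).measurable.comp
      (measurable_torusLift (d := 4) (G := G) (2 * S + 1))).aestronglyMeasurable C (ae_of_all _ fun U => ?_)
  have h : |∫ W, f W ∂(boxKernelG ρ β H (torusLift (2 * S + 1) U))| ≤ C := abs_integral_ymSpecification_le ρ hρc β _ hC _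
  rw [Real.norm_eq_abs]; exact h

/-- The torus integral of the box-kernel mean of a six-plane cost sum is the sum of the per-plane ones. -/
theorem integral_kernelMean_sixPlaneSum (hρc : Continuous ρ) (hρu : ∀ g, ρ g ∈ Matrix.unitaryGroup (Fin N) ℂ) (β : ℝ) (H S : ℕ)
    (x : Site 4) :
    ∫ U, (∫ W, ∑ q : {q : Fin 4 × Fin 4 // q.1 < q.2}, plaqCostAt ρ x q.1.1 q.1.2 W ∂(boxKernelG ρ β H (torusLift (2 * S + 1) U)))
        ∂(wilsonMeasure (d := 4) (L := 2 * S + 1) ρ β) =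
      ∑ q : {q : Fin 4 × Fin 4 // q.1 < q.2}, ∫ U, (∫ W, plaqCostAt ρ x q.1.1 q.1.2 W ∂(boxKernelG ρ β H (torusLift (2 * S + 1) U)))
        ∂(wilsonMeasure (d := 4) (L := 2 * S + 1) ρ β) := by
  haveI hKprob : ∀ U : GaugeConfig 4 (2 * S + 1) G, IsProbabilityMeasure (boxKernelG ρ β H (torusLift (2 * S + 1) U)) :=
    fun U => isProbabilityMeasure_boxKernelG ρ hρc β H _
  have e : ∀ U : GaugeConfig 4 (2 * S + 1) G,
      ∫ W, ∑ q : {q : Fin 4 × Fin 4 // q.1 < q.2}, plaqCostAt ρ x q.1.1 q.1.2 W ∂(boxKernelG ρ β H (torusLift (2 * S + 1) U)) =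
        ∑ q : {q : Fin 4 × Fin 4 // q.1 < q.2}, ∫ W, plaqCostAt ρ x q.1.1 q.1.2 W ∂(boxKernelG ρ β H (torusLift (2 * S + 1) U)) :=
    fun U => integral_finsetSum _ fun q _ => integrable_plaqCostAt_of_rep ρ hρc hρu _ _ _ _
  simp_rw [e]
  exact integral_finsetSum _ fun q _ => integrable_kernelMean_of_bound ρ hρc β H S (continuous_plaqCostAtG ρ hρc _ q.1.1 q.1.2)
    (abs_plaqCostAt_leG ρ hρu _ q.1.1 q.1.2)

/-- The torus integral of the box-kernel mean of the product of two six-plane cost sums is the double sum of the per-pair ones. -/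
theorem integral_kernelMean_sixPlaneProd (hρc : Continuous ρ) (hρu : ∀ g, ρ g ∈ Matrix.unitaryGroup (Fin N) ℂ) (β : ℝ) (H S : ℕ)
    (x y : Site 4) :
    ∫ U, (∫ W, (∑ q : {q : Fin 4 × Fin 4 // q.1 < q.2}, plaqCostAt ρ x q.1.1 q.1.2 W) *
          (∑ q : {q : Fin 4 × Fin 4 // q.1 < q.2}, plaqCostAt ρ y q.1.1 q.1.2 W) ∂(boxKernelG ρ β H (torusLift (2 * S + 1) U)))
        ∂(wilsonMeasure (d := 4) (L := 2 * S + 1) ρ β) =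
      ∑ q : {q : Fin 4 × Fin 4 // q.1 < q.2}, ∑ q' : {q : Fin 4 × Fin 4 // q.1 < q.2},
        ∫ U, (∫ W, plaqCostAt ρ x q.1.1 q.1.2 W * plaqCostAt ρ y q'.1.1 q'.1.2 W ∂(boxKernelG ρ β H (torusLift (2 * S + 1) U)))
          ∂(wilsonMeasure (d := 4) (L := 2 * S + 1) ρ β) := by
  haveI hKprob : ∀ U : GaugeConfig 4 (2 * S + 1) G, IsProbabilityMeasure (boxKernelG ρ β H (torusLift (2 * S + 1) U)) :=
    fun U => isProbabilityMeasure_boxKernelG ρ hρc β H _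
  have hcK2 : ∀ (q q' : {q : Fin 4 × Fin 4 // q.1 < q.2}) (W : LGConfig 4 G),
      |plaqCostAt ρ x q.1.1 q.1.2 W * plaqCostAt ρ y q'.1.1 q'.1.2 W| ≤ 2 * (N : ℝ) * (2 * (N : ℝ)) := fun q q' W => by
    rw [abs_mul]
    exact mul_le_mul (abs_plaqCostAt_leG ρ hρu _ q.1.1 q.1.2 W) (abs_plaqCostAt_leG ρ hρu _ q'.1.1 q'.1.2 W) (abs_nonneg _)
      (by positivity)
  have e : ∀ U : GaugeConfig 4 (2 * S + 1) G,
      ∫ W, (∑ q : {q : Fin 4 × Fin 4 // q.1 < q.2}, plaqCostAt ρ x q.1.1 q.1.2 W) *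
          (∑ q : {q : Fin 4 × Fin 4 // q.1 < q.2}, plaqCostAt ρ y q.1.1 q.1.2 W) ∂(boxKernelG ρ β H (torusLift (2 * S + 1) U)) =
        ∑ q : {q : Fin 4 × Fin 4 // q.1 < q.2}, ∑ q' : {q : Fin 4 × Fin 4 // q.1 < q.2},
          ∫ W, plaqCostAt ρ x q.1.1 q.1.2 W * plaqCostAt ρ y q'.1.1 q'.1.2 W ∂(boxKernelG ρ β H (torusLift (2 * S + 1) U)) := by
    intro U
    simp_rw [Finset.sum_mul_sum]
    rw [integral_finsetSum _ fun q _ => integrable_finsetSum _ fun q' _ => integrable_plaqCostAt_mul_of_rep' ρ hρc hρu _ _ _ _ _ _ _]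
    exact Finset.sum_congr rfl fun q _ => integral_finsetSum _ fun q' _ => integrable_plaqCostAt_mul_of_rep' ρ hρc hρu _ _ _ _ _ _ _
  simp_rw [e]
  have hIq : ∀ q q' : {q : Fin 4 × Fin 4 // q.1 < q.2}, Integrable (fun U : GaugeConfig 4 (2 * S + 1) G =>
      ∫ W, plaqCostAt ρ x q.1.1 q.1.2 W * plaqCostAt ρ y q'.1.1 q'.1.2 W ∂(boxKernelG ρ β H (torusLift (2 * S + 1) U)))
        (wilsonMeasure (d := 4) (L := 2 * S + 1) ρ β) := fun q q' =>
    integrable_kernelMean_of_bound ρ hρc β H S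
      ((continuous_plaqCostAtG ρ hρc _ q.1.1 q.1.2).mul (continuous_plaqCostAtG ρ hρc _ q'.1.1 q'.1.2)) (hcK2 q q')
  rw [integral_finsetSum _ fun q _ => integrable_finsetSum _ fun q' _ => hIq q q']
  exact Finset.sum_congr rfl fun q _ => integral_finsetSum _ fun q' _ => hIq q q'

/-- **The six-plane torus correlator through the box kernels.**  For `2(2H+T+2) < 2S+1`:
`⟨actionDensity ; actionDensity⟩_{torus 2S+1, T} = ∫ K_U[F·F'] dμ − (∫ K_U[F] dμ)·(∫ K_U[F'] dμ)` with `F = Σ_q c_{(c_H;q)}`,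
`F' = Σ_q c_{(c_H+Te₀;q)}`, `K_U = boxKernelG ρ β H (torusLift (2S+1) U)`, `μ = wilsonMeasure ρ β` (DLR + translation invariance, 36 pairs). -/
theorem sixPlane_torusCorr_eq_kernel (hρc : Continuous ρ) (hρu : ∀ g, ρ g ∈ Matrix.unitaryGroup (Fin N) ℂ) (β : ℝ) {H T S : ℕ}
    (hL : 2 * (2 * H + T + 2) < 2 * S + 1) :
    latticeConnectedCorr ρ β (2 * S + 1) (actionDensity ρ) (actionDensity ρ) T =
      (∫ U, (∫ W, (∑ q : {q : Fin 4 × Fin 4 // q.1 < q.2}, plaqCostAt ρ (boxCentre H) q.1.1 q.1.2 W) *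
            (∑ q : {q : Fin 4 × Fin 4 // q.1 < q.2}, plaqCostAt ρ (boxCentre H + Pi.single 0 (T : ℤ)) q.1.1 q.1.2 W)
              ∂(boxKernelG ρ β H (torusLift (2 * S + 1) U))) ∂(wilsonMeasure (d := 4) (L := 2 * S + 1) ρ β)) -
        (∫ U, (∫ W, ∑ q : {q : Fin 4 × Fin 4 // q.1 < q.2}, plaqCostAt ρ (boxCentre H) q.1.1 q.1.2 W
              ∂(boxKernelG ρ β H (torusLift (2 * S + 1) U))) ∂(wilsonMeasure (d := 4) (L := 2 * S + 1) ρ β)) *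
          (∫ U, (∫ W, ∑ q : {q : Fin 4 × Fin 4 // q.1 < q.2}, plaqCostAt ρ (boxCentre H + Pi.single 0 (T : ℤ)) q.1.1 q.1.2 W
              ∂(boxKernelG ρ β H (torusLift (2 * S + 1) U))) ∂(wilsonMeasure (d := 4) (L := 2 * S + 1) ρ β)) := by
  rw [latticeConnectedCorr_actionDensity_eq_sum_pairs ρ hρc hρu β (2 * S + 1) T, integral_kernelMean_sixPlaneProd ρ hρc hρu β H S,
    integral_kernelMean_sixPlaneSum ρ hρc hρu β H S, integral_kernelMean_sixPlaneSum ρ hρc hρu β H S, Finset.sum_mul_sum,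
    ← Finset.sum_sub_distrib]
  refine Finset.sum_congr rfl fun q _ => ?_
  rw [← Finset.sum_sub_distrib]
  refine Finset.sum_congr rfl fun q' _ => ?_
  exact latticeConnectedCorr_pair_eq_boxKernelG ρ hρc hρu β hL q q'

/-- **The six-plane torus means through the box kernels.**  For `2(2H+T+2) < 2S+1`: `∫ K_U[F] dμ = Σ_q ∫ plaqCost0 ρ q ∘ torusLift dμ` and
`∫ K_U[F'] dμ = Σ_q ∫ plaqCost0 ρ q ∘ torusLift dμ` (DLR + translation invariance, `torusMean_eq_kernelMean_pairG`). -/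
theorem sixPlane_torusMean_eq (hρc : Continuous ρ) (hρu : ∀ g, ρ g ∈ Matrix.unitaryGroup (Fin N) ℂ) (β : ℝ) {H T S : ℕ}
    (hL : 2 * (2 * H + T + 2) < 2 * S + 1) :
    (∫ U, (∫ W, ∑ q : {q : Fin 4 × Fin 4 // q.1 < q.2}, plaqCostAt ρ (boxCentre H) q.1.1 q.1.2 W
          ∂(boxKernelG ρ β H (torusLift (2 * S + 1) U))) ∂(wilsonMeasure (d := 4) (L := 2 * S + 1) ρ β) =
        ∑ q : {q : Fin 4 × Fin 4 // q.1 < q.2}, ∫ U, plaqCost0 ρ q.1.1 q.1.2 (torusLift (2 * S + 1) U)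
          ∂(wilsonMeasure (d := 4) (L := 2 * S + 1) ρ β)) ∧
      (∫ U, (∫ W, ∑ q : {q : Fin 4 × Fin 4 // q.1 < q.2}, plaqCostAt ρ (boxCentre H + Pi.single 0 (T : ℤ)) q.1.1 q.1.2 W
          ∂(boxKernelG ρ β H (torusLift (2 * S + 1) U))) ∂(wilsonMeasure (d := 4) (L := 2 * S + 1) ρ β) =
        ∑ q : {q : Fin 4 × Fin 4 // q.1 < q.2}, ∫ U, plaqCost0 ρ q.1.1 q.1.2 (torusLift (2 * S + 1) U)
          ∂(wilsonMeasure (d := 4) (L := 2 * S + 1) ρ β)) := by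
  obtain ⟨q₀⟩ : Nonempty {q : Fin 4 × Fin 4 // q.1 < q.2} := ⟨⟨((0 : Fin 4), (1 : Fin 4)), by decide⟩⟩
  have hmeanT := fun (q q' : {q : Fin 4 × Fin 4 // q.1 < q.2}) => torusMean_eq_kernelMean_pairG ρ hρc hρu β hL q q'
  rw [integral_kernelMean_sixPlaneSum ρ hρc hρu β H S, integral_kernelMean_sixPlaneSum ρ hρc hρu β H S]
  exact ⟨Finset.sum_congr rfl fun q _ => ((hmeanT q q₀).1).symm, Finset.sum_congr rfl fun q _ => ((hmeanT q₀ q).2).symm⟩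

end Summit.QuantumFields.YangMills.Theorems.SixPlaneColdBox

end
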